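import Literature.NumberTheory.LFunctions.SemimultiplicativeMoebiusKataiBilinear
import Mathlib.NumberTheory.ArithmeticFunction.Moebius
import Mathlib.Topology.Algebra.InfiniteSum.Real
import HarnessLib

/-!
# The Kátai–Bourgain–Sarnak–Ziegler criterion, III: the criterion (Konieczny 2020, Thm 2.1)

Topic `Literature/NumberTheory/LFunctions`. Everything in this file is PROVED. We finish the
proof of the qualitative criterion of Kátai (I. Kátai, Acta Math. Hungar. 47 (1986), Theorem;
Bourgain–Sarnak–Ziegler 2013, Theorem 2 is its quantitative form) exactly in the form printed
as **Theorem 2.1** of J. Konieczny, Monatsh. Math. 192 (2020) (arXiv:1808.06196, §2):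

> Suppose that `f : ℕ₀ → ℂ` is a bounded sequence such that for any pair of sufficiently large
> distinct primes `p, p'` it holds that `𝔼_{n<N} f(pn) conj f(p'n) → 0` as `N → ∞`.  Then for
> any multiplicative sequence `ν : ℕ₀ → 𝔻` it holds that `𝔼_{n<N} f(n) ν(n) → 0`.

* `Konieczny.katai_criterion` — the statement above for `1`-bounded `f` ("bounded" costs only a
  normalisation) and any `1`-bounded `ν` with `ν(pm) = ν(p)ν(m)` for primes `p ∤ m` (which is
  all that multiplicativity contributes); "sufficiently large" is an explicit threshold `P₀`.
* `Konieczny.katai_criterion_moebius` — the case `ν = μ` (Möbius), in the normalisation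
  `(N : ℂ)⁻¹ * ∑_{n ∈ range N} f n * μ n` of
  `Literature.NumberTheory.LFunctions.konieczny_semimultiplicative_moebius`.

Proof: given `ε`, take `P₁ > P₀` with `2/P₁ ≤ ε/8`, then (divergence of `∑ 1/p`, Mathlib's
`not_summable_one_div_on_primes`) a finite set `PP` of primes in `(P₁, y)` with
`A = ∑_{p∈PP} 1/p ≥ 64/ε² + 1`, then `η = 1/(#PP)²` and a common threshold beyond which all the
finitely many bilinear sums are `≤ η N`, and apply `Konieczny.katai_fixed_length`.
-/

noncomputable section

open Filter Finset
open scoped Topology ComplexConjugate ArithmeticFunction.Moebius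

namespace Literature.NumberTheory.LFunctions

namespace Konieczny

/-- **Divergence of `∑ 1/p`, finite form**: for every `P₁` and every bound `A₀` there is `y`
with `∑_{P₁ < p < y, p prime} 1/p ≥ A₀`. [folklore] -/
theorem exists_primes_sum_one_div_ge (P₁ : ℕ) (A₀ : ℝ) :
    ∃ y : ℕ, A₀ ≤ ∑ p ∈ (range y).filter (fun p => p.Prime ∧ P₁ < p), (1 / p : ℝ) := by
  set f : ℕ → ℝ := Set.indicator {p | p.Prime} (fun n : ℕ => (1 : ℝ) / n) with hf
  have hf0 : ∀ n, 0 ≤ f n := fun n => Set.indicator_nonneg (fun m _ => by positivity) n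
  have ht := (not_summable_iff_tendsto_nat_atTop_of_nonneg hf0).1 not_summable_one_div_on_primes
  obtain ⟨y, hy⟩ := (ht.eventually_ge_atTop (A₀ + (P₁ + 1))).exists
  refine ⟨y, ?_⟩
  have h1 : ∑ i ∈ range y, f i = ∑ p ∈ (range y).filter Nat.Prime, (1 / p : ℝ) := by
    rw [sum_filter]
    refine sum_congr rfl fun i _ => ?_
    simp only [hf, Set.indicator_apply, Set.mem_setOf_eq]
  have hsplit : ∑ i ∈ range y, f i =
      ∑ p ∈ (range y).filter (fun p => p.Prime ∧ P₁ < p), (1 / p : ℝ) +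
        ∑ p ∈ (range y).filter (fun p => p.Prime ∧ ¬ P₁ < p), (1 / p : ℝ) := by
    rw [h1, ← sum_filter_add_sum_filter_not ((range y).filter Nat.Prime) (fun p => P₁ < p),
      filter_filter, filter_filter]
  have hsmall : ∑ p ∈ (range y).filter (fun p => p.Prime ∧ ¬ P₁ < p), (1 / p : ℝ) ≤ P₁ + 1 := by
    calc ∑ p ∈ (range y).filter (fun p => p.Prime ∧ ¬ P₁ < p), (1 / p : ℝ)
        ≤ ∑ p ∈ (range y).filter (fun p => p.Prime ∧ ¬ P₁ < p), (1 : ℝ) := by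
          refine sum_le_sum fun p _ => ?_
          rcases Nat.eq_zero_or_pos p with h | h
          · simp [h]
          · rw [div_le_one (by exact_mod_cast h)]; exact_mod_cast h
      _ = #((range y).filter (fun p => p.Prime ∧ ¬ P₁ < p)) := by simp
      _ ≤ #(range (P₁ + 1)) := by
          have hsub : (range y).filter (fun p => p.Prime ∧ ¬ P₁ < p) ⊆ range (P₁ + 1) := by
            intro p hp
            rw [mem_filter] at hp
            rw [mem_range]; omega
          exact_mod_cast card_le_card hsub
      _ = P₁ + 1 := by simp
  linarith

/-- For `p, p' ≥ 1` the set `{m < N : pm < N ∧ p'm < N}` is an initial segment `range M`,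
`M ≤ N`. [folklore] -/
theorem filter_mul_lt_and_eq_range {p : ℕ} (hp : 0 < p) (p' N : ℕ) :
    ∃ M : ℕ, M ≤ N ∧ (range N).filter (fun m => p * m < N ∧ p' * m < N) = range M := by
  set c := max p p' with hc
  have hc0 : 0 < c := lt_of_lt_of_le hp (le_max_left _ _)
  refine ⟨(N + c - 1) / c, ?_, ?_⟩
  · rw [← not_lt]
    intro h
    have h1 := (lt_ceilDiv_iff hc0 N N).1 h
    have h2 : N ≤ c * N := Nat.le_mul_of_pos_left N hc0
    omega
  · ext m
    simp only [mem_filter, mem_range, lt_ceilDiv_iff hc0]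
    constructor
    · rintro ⟨-, h1, h2⟩
      rcases max_choice p p' with h | h
      · rw [hc, h]; exact h1
      · rw [hc, h]; exact h2
    · intro h
      have hpm : p * m ≤ c * m := Nat.mul_le_mul_right m (le_max_left _ _)
      have hpm' : p' * m ≤ c * m := Nat.mul_le_mul_right m (le_max_right _ _)
      have hm : m ≤ c * m := Nat.le_mul_of_pos_left m hc0
      exact ⟨lt_of_le_of_lt hm h, lt_of_le_of_lt hpm h, lt_of_le_of_lt hpm' h⟩

/-- **The Kátai–Bourgain–Sarnak–Ziegler criterion** (Kátai 1986, Theorem; Konieczny 2020,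
Theorem 2.1, as printed there): let `F : ℕ → ℂ` be `1`-bounded and suppose that for every pair
of distinct primes `p, p' > P₀` one has `𝔼_{n<N} F(pn) conj F(p'n) → 0`.  Then
`𝔼_{n<N} F(n) ν(n) → 0` for every `1`-bounded `ν : ℕ → ℂ` with `ν(pm) = ν(p) ν(m)` for all
primes `p` and all `m` with `p ∤ m` (in particular every multiplicative `ν` with `|ν| ≤ 1`).
Here `𝔼_{n<N} = (1/N) ∑_{n=0}^{N-1}`. [cite: Konieczny2020, Theorem 2.1] -/
theorem katai_criterion {F ν : ℕ → ℂ} (hF : ∀ n, ‖F n‖ ≤ 1) (hν1 : ∀ n, ‖ν n‖ ≤ 1)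
    (hν : ∀ p m : ℕ, p.Prime → ¬ p ∣ m → ν (p * m) = ν p * ν m) (P₀ : ℕ)
    (hcorr : ∀ p p' : ℕ, p.Prime → p'.Prime → p ≠ p' → P₀ < p → P₀ < p' →
      Tendsto (fun N : ℕ => (N : ℂ)⁻¹ * ∑ n ∈ range N, F (p * n) * conj (F (p' * n)))
        atTop (𝓝 0)) :
    Tendsto (fun N : ℕ => (N : ℂ)⁻¹ * ∑ n ∈ range N, F n * ν n) atTop (𝓝 0) := by
  rw [Metric.tendsto_atTop]
  intro ε hε
  -- the parameter `P₁`
  set P₁ : ℕ := max (P₀ + 1) (⌈16 / ε⌉₊ + 1) with hP₁def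
  have hP₀P₁ : P₀ < P₁ := lt_of_lt_of_le (Nat.lt_succ_self P₀) (le_max_left _ _)
  have hP₁0 : 0 < P₁ := lt_of_le_of_lt (Nat.zero_le _) hP₀P₁
  have hP₁r : (0 : ℝ) < P₁ := by exact_mod_cast hP₁0
  have hP₁ε : (2 : ℝ) / P₁ ≤ ε / 8 := by
    have h1 : (16 / ε : ℝ) ≤ P₁ := by
      calc (16 / ε : ℝ) ≤ ⌈16 / ε⌉₊ := Nat.le_ceil _
        _ ≤ ((⌈16 / ε⌉₊ + 1 : ℕ) : ℝ) := by push_cast; linarith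
        _ ≤ P₁ := by exact_mod_cast le_max_right _ _
    rw [div_le_iff₀ hε] at h1
    rw [div_le_iff₀ hP₁r]
    linarith
  -- the set of primes `PP`
  obtain ⟨y, hy⟩ := exists_primes_sum_one_div_ge P₁ (64 / ε ^ 2 + 1)
  set PP : Finset ℕ := (range y).filter (fun p => p.Prime ∧ P₁ < p) with hPPdef
  have hPPpr : ∀ p ∈ PP, p.Prime := fun p hp => ((mem_filter.1 hp).2).1
  have hPPP : ∀ p ∈ PP, P₁ < p := fun p hp => ((mem_filter.1 hp).2).2
  set A : ℝ := ∑ p ∈ PP, (1 / p : ℝ) with hAdef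
  have hA : 64 / ε ^ 2 + 1 ≤ A := hy
  have hε2 : 0 < 64 / ε ^ 2 := by positivity
  have hA1 : 1 ≤ A := by linarith
  have hApos : 0 < A := by linarith
  have hAε : 64 ≤ A * ε ^ 2 := by
    have : 64 / ε ^ 2 ≤ A := by linarith
    rwa [div_le_iff₀ (by positivity)] at this
  set P : ℕ := #PP with hPdef
  have hPpos : 0 < P := by
    rw [hPdef, card_pos]
    by_contra h
    rw [not_nonempty_iff_eq_empty] at h
    have : A = 0 := by rw [hAdef, h, sum_empty]
    linarith
  have hPr : (0 : ℝ) < P := by exact_mod_cast hPpos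
  have hP1 : (1 : ℝ) ≤ P := by exact_mod_cast hPpos
  set η : ℝ := 1 / (P : ℝ) ^ 2 with hηdef
  have hη0 : 0 < η := by positivity
  have hPη : (P : ℝ) ^ 2 * η = 1 := by rw [hηdef]; field_simp
  -- a common threshold for the finitely many bilinear sums
  have hpairs : ∀ᶠ M : ℕ in atTop, ∀ pp ∈ PP ×ˢ PP, pp.1 ≠ pp.2 →
      ‖∑ m ∈ range M, F (pp.1 * m) * conj (F (pp.2 * m))‖ ≤ η / 2 * M := by
    rw [eventually_all_finset]
    intro pp hpp
    rw [mem_product] at hpp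
    by_cases hne : pp.1 = pp.2
    · exact Eventually.of_forall fun M h => absurd hne h
    · have ht := hcorr pp.1 pp.2 (hPPpr _ hpp.1) (hPPpr _ hpp.2) hne
        (hP₀P₁.trans (hPPP _ hpp.1)) (hP₀P₁.trans (hPPP _ hpp.2))
      rw [Metric.tendsto_atTop] at ht
      obtain ⟨M₀, hM₀⟩ := ht (η / 2) (by positivity)
      refine eventually_atTop.2 ⟨max M₀ 1, fun M hM _ => ?_⟩
      have h := hM₀ M (le_of_max_le_left hM)
      rw [dist_zero_right, norm_mul, norm_inv, Complex.norm_natCast] at h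
      have hMpos : (0 : ℝ) < M := by exact_mod_cast le_of_max_le_right hM
      calc ‖∑ m ∈ range M, F (pp.1 * m) * conj (F (pp.2 * m))‖
          = M * ((M : ℝ)⁻¹ * ‖∑ m ∈ range M, F (pp.1 * m) * conj (F (pp.2 * m))‖) := by
            field_simp
        _ ≤ M * (η / 2) := mul_le_mul_of_nonneg_left h.le hMpos.le
        _ = η / 2 * M := by ring
  obtain ⟨M₀, hM₀⟩ := eventually_atTop.1 hpairs
  -- the final threshold
  refine ⟨max (4 * P ^ 2) (max ⌈32 * P / (A * ε)⌉₊ ⌈2 * M₀ / η⌉₊) + 1, fun N hN => ?_⟩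
  have hN1 : 1 ≤ N := le_trans (Nat.le_add_left 1 _) hN
  have hNr : (0 : ℝ) < N := by exact_mod_cast hN1
  have hN4 : (4 : ℝ) * P ^ 2 ≤ N := by
    have : 4 * P ^ 2 ≤ N := le_trans (le_trans (le_max_left _ _) (Nat.le_succ _)) hN
    exact_mod_cast this
  have hNP : (P : ℝ) ≤ N := by nlinarith
  have hN32 : 32 * P / (A * ε) ≤ N := by
    calc 32 * P / (A * ε) ≤ ⌈32 * P / (A * ε)⌉₊ := Nat.le_ceil _
      _ ≤ N := by
          have : ⌈32 * P / (A * ε)⌉₊ ≤ N :=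
            le_trans (le_trans ((le_max_left _ _).trans (le_max_right _ _)) (Nat.le_succ _)) hN
          exact_mod_cast this
  have hNM : 2 * M₀ / η ≤ N := by
    calc 2 * M₀ / η ≤ ⌈2 * M₀ / η⌉₊ := Nat.le_ceil _
      _ ≤ N := by
          have : ⌈2 * (M₀ : ℝ) / η⌉₊ ≤ N :=
            le_trans (le_trans ((le_max_right _ _).trans (le_max_right _ _)) (Nat.le_succ _)) hN
          exact_mod_cast this
  have hM₀η : (M₀ : ℝ) ≤ η * N / 2 := by
    rw [div_le_iff₀ hη0] at hNM
    linarith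
  -- the bilinear hypothesis at length `N`
  have hcorrN : ∀ p ∈ PP, ∀ p' ∈ PP, p ≠ p' →
      ‖∑ m ∈ (range N).filter (fun m => p * m < N ∧ p' * m < N),
          F (p * m) * conj (F (p' * m))‖ ≤ η * N := by
    intro p hp p' hp' hne
    obtain ⟨M, hMN, hMeq⟩ := filter_mul_lt_and_eq_range (hPPpr p hp).pos p' N
    rw [hMeq]
    have hMNr : (M : ℝ) ≤ N := by exact_mod_cast hMN
    by_cases hM : M₀ ≤ M
    · have h := hM₀ M hM (p, p') (mem_product.2 ⟨hp, hp'⟩) hne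
      calc _ ≤ η / 2 * M := h
        _ ≤ η * N := by nlinarith
    · calc ‖∑ m ∈ range M, F (p * m) * conj (F (p' * m))‖
          ≤ ∑ m ∈ range M, ‖F (p * m) * conj (F (p' * m))‖ := norm_sum_le _ _
        _ ≤ ∑ m ∈ range M, (1 : ℝ) := by
            refine sum_le_sum fun m _ => ?_
            rw [norm_mul, Complex.norm_conj]
            calc ‖F (p * m)‖ * ‖F (p' * m)‖ ≤ 1 * 1 :=
                mul_le_mul (hF _) (hF _) (norm_nonneg _) zero_le_one
              _ = 1 := one_mul _
        _ = M := by simp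
        _ ≤ M₀ := by exact_mod_cast (not_le.1 hM).le
        _ ≤ η * N := by nlinarith
  have hmain := katai_fixed_length PP hPPpr hP₁0 hPPP hF hν1 hν N hη0.le hcorrN
  rw [← hAdef, ← hPdef] at hmain
  -- numerics
  set S : ℝ := ‖∑ n ∈ range N, F n * ν n‖ with hSdef
  have hsqrtA : Real.sqrt (2 * A + 2) ≤ A * ε / 4 := by
    rw [Real.sqrt_le_iff]
    refine ⟨by positivity, ?_⟩
    nlinarith
  have hsq0 : 0 ≤ (N : ℝ) * Real.sqrt (2 * A + 2) := by positivity
  have hT1 : Real.sqrt (N * (2 * N * A + 4 * (P : ℝ) ^ 2)) ≤ N * Real.sqrt (2 * A + 2) := by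
    rw [Real.sqrt_le_iff]
    refine ⟨hsq0, ?_⟩
    rw [mul_pow, Real.sq_sqrt (by positivity)]
    nlinarith
  have hT3 : Real.sqrt (N * (N * A + P + (P : ℝ) ^ 2 * η * N)) ≤ N * Real.sqrt (2 * A + 2) := by
    rw [hPη, one_mul, Real.sqrt_le_iff]
    refine ⟨hsq0, ?_⟩
    rw [mul_pow, Real.sq_sqrt (by positivity)]
    nlinarith
  have hT2a : 2 * N * A / P₁ ≤ A * N * (ε / 8) := by
    have : 2 * N * A / P₁ = A * N * (2 / P₁) := by ring
    rw [this]
    exact mul_le_mul_of_nonneg_left hP₁ε (by positivity)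
  have hT2b : (4 : ℝ) * P ≤ A * N * (ε / 8) := by
    rw [div_le_iff₀ (by positivity)] at hN32
    linarith
  have hAS : A * S ≤ A * (N * (3 * ε / 4)) := by
    calc A * S ≤ _ := hmain
      _ ≤ N * Real.sqrt (2 * A + 2) + (A * N * (ε / 8) + A * N * (ε / 8)) +
            N * Real.sqrt (2 * A + 2) := add_le_add (add_le_add hT1 (add_le_add hT2a hT2b)) hT3
      _ ≤ N * (A * ε / 4) + (A * N * (ε / 8) + A * N * (ε / 8)) + N * (A * ε / 4) := by
          gcongr
      _ = A * (N * (3 * ε / 4)) := by ring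
  have hS : S ≤ N * (3 * ε / 4) := le_of_mul_le_mul_left hAS hApos
  rw [dist_zero_right, norm_mul, norm_inv, Complex.norm_natCast, ← hSdef]
  calc (N : ℝ)⁻¹ * S ≤ (N : ℝ)⁻¹ * (N * (3 * ε / 4)) := by gcongr
    _ = 3 * ε / 4 := by field_simp
    _ < ε := by linarith

/-- **Konieczny 2020, Theorem 2.1 for the Möbius function**: if `F : ℕ → ℂ` is `1`-bounded and
`𝔼_{n<N} F(pn) conj F(p'n) → 0` for all distinct primes `p, p' > P₀`, then
`𝔼_{n<N} F(n) μ(n) → 0`. [cite: Konieczny2020, Theorem 2.1] -/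
theorem katai_criterion_moebius {F : ℕ → ℂ} (hF : ∀ n, ‖F n‖ ≤ 1) (P₀ : ℕ)
    (hcorr : ∀ p p' : ℕ, p.Prime → p'.Prime → p ≠ p' → P₀ < p → P₀ < p' →
      Tendsto (fun N : ℕ => (N : ℂ)⁻¹ * ∑ n ∈ range N, F (p * n) * conj (F (p' * n)))
        atTop (𝓝 0)) :
    Tendsto (fun N : ℕ => (N : ℂ)⁻¹ * ∑ n ∈ range N, F n * (μ n : ℂ)) atTop (𝓝 0) := by
  refine katai_criterion hF (ν := fun n => (μ n : ℂ)) (fun n => ?_) (fun p m hp hpm => ?_) P₀ hcorr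
  · rw [Complex.norm_intCast]
    exact_mod_cast ArithmeticFunction.abs_moebius_le_one
  · have hcop : Nat.Coprime p m := (Nat.Prime.coprime_iff_not_dvd hp).2 hpm
    have := ArithmeticFunction.isMultiplicative_moebius.map_mul_of_coprime hcop
    show ((μ (p * m) : ℤ) : ℂ) = (μ p : ℂ) * (μ m : ℂ)
    rw [this]; push_cast; ring

end Konieczny

end Literature.NumberTheory.LFunctions
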